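import Summits.CriticalPhenomena.PercolationContinuityZ3.Theorems.PercNearOneGluingNoHeavyPcintChordRandReduction
import HarnessLib

/-!
# PCINT lane: the geodesic-word union bound is asymptotically EXACT (REDUCTIONS.md §R7.1, kernel form)

Cell `prim-pcint`, seat `prim-pcint-2` (gen 7); memo `run/shared/lean/prim/pcint/REDUCTIONS.md` §R7.1
(refereed gen 63) and `prim-pcint-2/gen6/README.md` §1.  Does NOT build on p205010.

Every certified lower bound of the lane for `p_c^bond(ℤ^d)` (kinds B3, B3r, B3c, B3t, B3m) is a union
bound, over the words `γ` of length `n`, of window-computable upper estimates for the probability of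
`minGeoEvent o γ = {γ is the code-least open geodesic word of length n}` (orders `o`;
`minGeoEvent_subset_chordRandEvent`).  The union bound itself loses NOTHING in the limit: `code o` is
injective, so the events `minGeoEvent o γ` are pairwise disjoint and their union over
`γ ∈ sawWords d n` is EXACTLY `geoNonempty d n = {an open geodesic word of length n exists}`
(`geoNonempty_eq_biUnion`, `sum_measureReal_minGeoEvent`: `Σ_γ P_p(minGeoEvent o γ) =
P_p(geoNonempty d n)` for any `o`); `geoNonempty d n` decreases in `n` to `{|C(0)| = ∞}` off the null
set `{ω ⊄ E(𝕃^d)}` (`iInter_geoNonempty_inter_goodCfg`); hence for EVERY choice of orders `o n`,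
`Σ_{γ ∈ sawWords d n} P_p(minGeoEvent (o n) γ) → θ(p)` from above (`tendsto_sum_minGeoEvent`,
`theta_le_sum_minGeoEvent`), the limit being `0` for `p < p_c`
(`tendsto_sum_minGeoEvent_of_lt_criticalProb`).  So the whole distance between a certified threshold
and `p_c` is the slack of the WEIGHTS; none is in the union bound.
-/

noncomputable section

namespace Summit.CriticalPhenomena.PercolationContinuityZ3.Theorems.Pcint

open Finset MeasureTheory Filter Topology
open Literature.Probability.Percolation Literature.Probability.LatticeModels

variable {d n : ℕ}

/-! ### Codes are injective; the code-least open geodesic word -/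

/-- The code of a word under a family of sibling orders determines the word (digit `t` is the image of
`γ_t` under a permutation that depends only on the prefix `γ|_t`). [folklore] -/
theorem code_injective (o : Orders d n) : Function.Injective (code o) := by
  intro γ γ' h
  have hd : digit o γ = digit o γ' := toLex_inj.1 h
  have key : ∀ t : ℕ, ∀ ht : t < n, γ ⟨t, ht⟩ = γ' ⟨t, ht⟩ := by
    intro t
    induction t using Nat.strong_induction_on with
    | _ t ih =>
      intro ht
      have hp : pnode γ ⟨t, ht⟩ = pnode γ' ⟨t, ht⟩ := by
        simp only [pnode]
        refine Sigma.ext rfl (heq_of_eq ?_)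
        funext i
        exact ih i.1 i.2 (lt_trans i.2 ht)
      have ht' := congrFun hd ⟨t, ht⟩
      simp only [digit] at ht'
      rw [hp] at ht'
      exact (o (pnode γ' ⟨t, ht⟩)).injective (dirCode_injective ht')
  funext t
  exact key t.1 t.2

/-- The event "`γ` is THE code-least open geodesic word of length `n`" (for the orders `o`): `γ` is an
open geodesic word and every open geodesic word of length `n` has code at least `code o γ`.
REDUCTIONS.md §R7.1. [folklore] -/
def minGeoEvent (o : Orders d n) (γ : Fin n → Fin d × Bool) : Set (BondConfig (Site d)) :=
  {ω | γ ∈ bgeoWords ω n ∧ ∀ γ' ∈ bgeoWords ω n, code o γ ≤ code o γ'}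

/-- The event "some open geodesic word of length `n` exists", i.e. `C(0)` reaches open-graph distance
`n` along lattice steps. [folklore] -/
def geoNonempty (d n : ℕ) : Set (BondConfig (Site d)) := {ω | (bgeoWords ω n).Nonempty}

/-- The events `minGeoEvent o γ` realise the lane's certified events: `minGeoEvent o γ ⊆ chordRandEvent o γ`
on `{ω ⊆ E(𝕃^d)}` (so every kind's weight is an upper estimate of `P_p(minGeoEvent o γ)`). [folklore] -/
theorem minGeoEvent_subset_chordRandEvent (o : Orders d n) (γ : Fin n → Fin d × Bool) :
    minGeoEvent o γ ∩ {ω | ω ⊆ (zdGraph d).edgeSet} ⊆ chordRandEvent o γ := fun _ ⟨⟨hγ, hmin⟩, hω⟩ =>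
  mem_chordRandEvent_of_minimal hω hγ hmin

/-- Distinct words give DISJOINT events `minGeoEvent o γ`. [folklore] -/
theorem minGeoEvent_disjoint (o : Orders d n) {γ γ' : Fin n → Fin d × Bool} (h : γ ≠ γ') :
    Disjoint (minGeoEvent o γ) (minGeoEvent o γ') := by
  rw [Set.disjoint_left]
  rintro ω ⟨hγ, hmin⟩ ⟨hγ', hmin'⟩
  exact h (code_injective o (le_antisymm (hmin γ' hγ') (hmin' γ hγ)))

/-- `minGeoEvent o γ = ∅` unless `γ` is self-avoiding. [folklore] -/
theorem minGeoEvent_eq_empty_of_not_mem (o : Orders d n) {γ : Fin n → Fin d × Bool}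
    (h : γ ∉ sawWords d n) : minGeoEvent o γ = ∅ :=
  Set.eq_empty_iff_forall_notMem.2 fun _ hω => h (mem_sawWords_of_mem_bgeoWords hω.1)

/-- **The union bound is an identity at the level of events**: `geoNonempty d n` is the (disjoint)
union of the events `minGeoEvent o γ`, `γ ∈ sawWords d n`, for ANY orders `o`. [folklore] -/
theorem geoNonempty_eq_biUnion (o : Orders d n) :
    geoNonempty d n = ⋃ γ ∈ sawWords d n, minGeoEvent o γ := by
  ext ω
  constructor
  · intro hne
    obtain ⟨γ, hγ, hmin⟩ := exists_min_image (bgeoWords ω n) (code o) hne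
    exact Set.mem_biUnion (mem_coe.2 (mem_sawWords_of_mem_bgeoWords hγ)) ⟨hγ, hmin⟩
  · intro h
    simp only [Set.mem_iUnion] at h
    obtain ⟨γ, -, hγ⟩ := h
    exact ⟨γ, hγ.1⟩

/-! ### Monotonicity in `n` and the limit event -/

/-- Positions of the prefix `Fin.init γ` agree with those of `γ`. [folklore] -/
theorem wordPos_init (γ : Fin (n + 1) → Fin d × Bool) {k : ℕ} (hk : k ≤ n) :
    wordPos (Fin.init γ) k = wordPos γ k := by
  induction k with
  | zero => simp
  | succ k ih =>
    rw [wordPos_succ _ (by omega : k < n), wordPos_succ _ (by omega : k < n + 1), ih (by omega)]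
    rfl

/-- Edges of the prefix are edges of the word. [folklore] -/
theorem wordEdges_init_subset (γ : Fin (n + 1) → Fin d × Bool) : wordEdges (Fin.init γ) ⊆ wordEdges γ := by
  intro e he
  rw [wordEdges, mem_image] at he ⊢
  obtain ⟨k, hk, rfl⟩ := he
  rw [mem_range] at hk
  exact ⟨k, mem_range.2 (by omega), by rw [wordPos_init γ hk.le, wordPos_init γ hk]⟩

/-- The prefix of an open geodesic word is an open geodesic word. [folklore] -/
theorem init_mem_bgeoWords {ω : BondConfig (Site d)} {γ : Fin (n + 1) → Fin d × Bool}
    (hγ : γ ∈ bgeoWords ω (n + 1)) : Fin.init γ ∈ bgeoWords ω n := by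
  obtain ⟨hopen, hdist⟩ := mem_bgeoWords.1 hγ
  refine mem_bgeoWords.2 ⟨fun e he => hopen (mem_coe.2 (wordEdges_init_subset γ (mem_coe.1 he))), ?_⟩
  rw [wordPos_init γ le_rfl]
  obtain ⟨W, hW⟩ := exists_openWalk_wordPos_bond hopen (Nat.zero_le n) (Nat.le_succ n)
  have hWle := SimpleGraph.dist_le W
  rw [hW, wordPos_zero] at hWle
  apply le_antisymm
  · omega
  · by_contra hlt
    push Not at hlt
    obtain ⟨Q, hQ⟩ := W.reachable.exists_walk_length_eq_dist
    have hadj : (openGraph ω).Adj (wordPos γ n) (wordPos γ (n + 1)) :=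
      (openGraph_adj ω _ _).2 ⟨hopen (mem_coe.2 (edge_mem_wordEdges γ (Nat.lt_succ_self n))),
        (zdGraph_adj_wordPos_succ γ (Nat.lt_succ_self n)).ne⟩
    have hle := SimpleGraph.dist_le (Q.concat hadj)
    rw [SimpleGraph.Walk.length_concat, hQ, wordPos_zero, hdist] at hle
    omega

/-- `geoNonempty d n` is non-increasing in `n`. [folklore] -/
theorem geoNonempty_antitone (d : ℕ) : Antitone (geoNonempty d) := by
  refine antitone_nat_of_succ_le fun n ω hω => ?_
  obtain ⟨γ, hγ⟩ := hω
  exact ⟨Fin.init γ, init_mem_bgeoWords hγ⟩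

/-- If `C(0)` is finite, there is no open geodesic word longer than `|C(0)|`. [folklore] -/
theorem bgeoWords_eq_empty_of_finite {ω : BondConfig (Site d)} (hfin : (openCluster ω 0).Finite)
    (hn : hfin.toFinset.card ≤ n) : bgeoWords ω n = ∅ := by
  rw [Finset.eq_empty_iff_forall_notMem]
  intro γ hγ
  have hopen := (mem_bgeoWords.1 hγ).1
  have hsaw := isSAW_of_mem_bgeoWords hγ
  have hmaps : ∀ i ∈ range (n + 1), wordPos γ i ∈ hfin.toFinset := by
    intro i hi
    rw [Set.Finite.mem_toFinset]
    obtain ⟨W, -⟩ := exists_openWalk_wordPos_bond hopen (Nat.zero_le i) (Nat.le_of_lt_succ (mem_range.1 hi))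
    rw [wordPos_zero] at W
    exact ⟨W⟩
  have hinj : Set.InjOn (fun i => wordPos γ i) ↑(range (n + 1)) := fun i hi j hj h =>
    hsaw i j (Nat.le_of_lt_succ (mem_range.1 (mem_coe.1 hi))) (Nat.le_of_lt_succ (mem_range.1 (mem_coe.1 hj))) h
  have := Finset.card_le_card_of_injOn _ hmaps hinj
  rw [card_range] at this
  omega

/-- The set of lattice configurations `{ω ⊆ E(𝕃^d)}` (full `P_p`-measure). [folklore] -/
def goodCfg (d : ℕ) : Set (BondConfig (Site d)) := {ω | ω ⊆ (zdGraph d).edgeSet}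

/-- **The limit event.** Off the null set `{ω ⊄ E(𝕃^d)}`: an open geodesic word of EVERY length exists
iff `|C(0)| = ∞`. [folklore] -/
theorem iInter_geoNonempty_inter_goodCfg (d : ℕ) :
    (⋂ n, geoNonempty d n) ∩ goodCfg d = percolatesAt (0 : Site d) ∩ goodCfg d := by
  ext ω
  simp only [Set.mem_inter_iff, Set.mem_iInter, geoNonempty, Set.mem_setOf_eq]
  constructor
  · rintro ⟨h, hω⟩
    refine ⟨?_, hω⟩
    by_contra hfin
    have hfin' : (openCluster ω 0).Finite := Set.not_infinite.1 hfin
    have := h hfin'.toFinset.card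
    rw [bgeoWords_eq_empty_of_finite hfin' le_rfl] at this
    exact Finset.not_nonempty_empty this
  · rintro ⟨h, hω⟩
    exact ⟨fun n => bgeoWords_nonempty_of_percolatesAt hω h n, hω⟩

/-- `{|C(0)| = ∞} ∩ {ω ⊆ E} ⊆ geoNonempty d n` for every `n`. [folklore] -/
theorem percolatesAt_inter_goodCfg_subset (d n : ℕ) :
    percolatesAt (0 : Site d) ∩ goodCfg d ⊆ geoNonempty d n := fun _ ⟨h, hω⟩ =>
  bgeoWords_nonempty_of_percolatesAt hω h n

/-! ### Measurability (via a cylinder description valid on `{ω ⊆ E(𝕃^d)}`) -/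

/-- The event "some word of length `k` ending at `x` is open". [folklore] -/
def openWordTo (k : ℕ) (x : Site d) : Set (BondConfig (Site d)) :=
  {ω | ∃ w : Fin k → Fin d × Bool, wordPos w k = x ∧ (↑(wordEdges w) : Set (Sym2 (Site d))) ⊆ ω}

/-- "All edges of the word `w` are open" is measurable (a finite-dimensional cylinder; cf.
`FK.KNFree.measurableSet_subset` for general finite edge sets, not imported here). [folklore] -/
theorem measurableSet_wordEdges_subset {k : ℕ} (w : Fin k → Fin d × Bool) :
    MeasurableSet {ω : BondConfig (Site d) | (↑(wordEdges w) : Set (Sym2 (Site d))) ⊆ ω} := by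
  have : {ω : BondConfig (Site d) | (↑(wordEdges w) : Set (Sym2 (Site d))) ⊆ ω} =
      ⋂ e ∈ wordEdges w, {ω | e ∈ ω} := by
    ext ω
    simp only [Set.mem_setOf_eq, Set.mem_iInter, Set.subset_def, mem_coe]
  rw [this]
  exact (wordEdges w).measurableSet_biInter fun e _ => measurableSet_mem e

/-- `openWordTo k x` is measurable. [folklore] -/
theorem measurableSet_openWordTo (k : ℕ) (x : Site d) : MeasurableSet (openWordTo (d := d) k x) := by
  have : openWordTo (d := d) k x =
      ⋃ w : Fin k → Fin d × Bool, ({ω | wordPos w k = x} ∩ {ω | (↑(wordEdges w) : Set (Sym2 (Site d))) ⊆ ω}) := by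
    ext ω
    simp only [openWordTo, Set.mem_setOf_eq, Set.mem_iUnion, Set.mem_inter_iff]
  rw [this]
  exact MeasurableSet.iUnion fun w => (MeasurableSet.const _).inter (measurableSet_wordEdges_subset w)

/-- Cylinder description of "`γ` is an open geodesic word": its edges are open and no word shorter than
`n` ending at its endpoint is open (a measurable event). [folklore] -/
def geoWordEvent (γ : Fin n → Fin d × Bool) : Set (BondConfig (Site d)) :=
  {ω | (↑(wordEdges γ) : Set (Sym2 (Site d))) ⊆ ω} ∩ ⋂ k ∈ range n, (openWordTo k (wordPos γ n))ᶜ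

/-- `geoWordEvent γ` is measurable. [folklore] -/
theorem measurableSet_geoWordEvent (γ : Fin n → Fin d × Bool) : MeasurableSet (geoWordEvent γ) :=
  (measurableSet_wordEdges_subset γ).inter
    ((range n).measurableSet_biInter fun k _ => (measurableSet_openWordTo k _).compl)

/-- On `{ω ⊆ E(𝕃^d)}`, `γ ∈ bgeoWords ω n ↔ ω ∈ geoWordEvent γ`. [folklore] -/
theorem mem_bgeoWords_iff_mem_geoWordEvent {ω : BondConfig (Site d)} (hω : ω ∈ goodCfg d)
    (γ : Fin n → Fin d × Bool) : γ ∈ bgeoWords ω n ↔ ω ∈ geoWordEvent γ := by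
  have hG : openGraph ω ≤ zdGraph d := by
    intro a b hab
    rw [openGraph_adj] at hab
    exact hω hab.1
  rw [mem_bgeoWords, geoWordEvent, Set.mem_inter_iff, Set.mem_setOf_eq]
  refine and_congr_right fun hopen => ?_
  simp only [Set.mem_iInter, Set.mem_compl_iff, mem_range]
  constructor
  · intro hdist k hk hk'
    obtain ⟨w, hwx, hwo⟩ := hk'
    obtain ⟨W, hW⟩ := exists_openWalk_wordPos_bond hwo (Nat.zero_le k) le_rfl
    have := SimpleGraph.dist_le W
    rw [hW, wordPos_zero, hwx] at this
    omega
  · intro h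
    obtain ⟨W, hW⟩ := exists_openWalk_wordPos_bond hopen (Nat.zero_le n) le_rfl
    have hWle := SimpleGraph.dist_le W
    rw [hW, wordPos_zero] at hWle
    apply le_antisymm
    · omega
    · by_contra hlt
      push Not at hlt
      obtain ⟨Q, hQ⟩ := W.reachable.exists_walk_length_eq_dist
      set m := (openGraph ω).dist 0 (wordPos γ n) with hm
      have hQ' : (Q.copy (wordPos_zero γ) rfl).length = m := by
        rw [SimpleGraph.Walk.length_copy, hQ, wordPos_zero]
      obtain ⟨w, hw⟩ := exists_word_of_walk hG (Q.copy (wordPos_zero γ) rfl) m (by omega)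
      refine h m hlt ⟨w, ?_, ?_⟩
      · rw [hw m le_rfl, ← hQ', SimpleGraph.Walk.getVert_length]
      · intro e he
        rw [mem_coe, wordEdges, mem_image] at he
        obtain ⟨k, hk, rfl⟩ := he
        rw [mem_range] at hk
        rw [hw k hk.le, hw (k + 1) (by omega)]
        exact ((openGraph_adj ω _ _).1 ((Q.copy (wordPos_zero γ) rfl).adj_getVert_succ (by omega))).1

/-- Cylinder description of `minGeoEvent o γ` (valid on `{ω ⊆ E}`): `γ` is an open geodesic word and no
word of smaller code is. [folklore] -/
def minGeoCyl (o : Orders d n) (γ : Fin n → Fin d × Bool) : Set (BondConfig (Site d)) :=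
  geoWordEvent γ ∩ ⋂ γ' ∈ (univ.filter fun γ' => code o γ' < code o γ), (geoWordEvent γ')ᶜ

/-- `minGeoCyl o γ` is measurable. [folklore] -/
theorem measurableSet_minGeoCyl (o : Orders d n) (γ : Fin n → Fin d × Bool) :
    MeasurableSet (minGeoCyl o γ) :=
  (measurableSet_geoWordEvent γ).inter
    (Finset.measurableSet_biInter _ fun γ' _ => (measurableSet_geoWordEvent γ').compl)

/-- On `{ω ⊆ E}`, `minGeoEvent o γ` and its cylinder description agree. [folklore] -/
theorem mem_minGeoEvent_iff_mem_minGeoCyl {ω : BondConfig (Site d)} (hω : ω ∈ goodCfg d)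
    (o : Orders d n) (γ : Fin n → Fin d × Bool) : ω ∈ minGeoEvent o γ ↔ ω ∈ minGeoCyl o γ := by
  rw [minGeoEvent, Set.mem_setOf_eq, minGeoCyl, Set.mem_inter_iff, mem_bgeoWords_iff_mem_geoWordEvent hω]
  refine and_congr_right fun _ => ?_
  simp only [Set.mem_iInter, Set.mem_compl_iff, mem_filter, mem_univ, true_and]
  constructor
  · intro h γ' hlt hγ'
    exact absurd (h γ' ((mem_bgeoWords_iff_mem_geoWordEvent hω γ').2 hγ')) (not_le.2 hlt)
  · intro h γ' hγ'
    by_contra hlt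
    exact h γ' (not_le.1 hlt) ((mem_bgeoWords_iff_mem_geoWordEvent hω γ').1 hγ')

/-! ### Measure statements -/

/-- `P_p`-almost every configuration lies in `E(𝕃^d)`. [folklore] -/
theorem ae_mem_goodCfg (d : ℕ) (p : unitInterval) :
    ∀ᵐ ω ∂(bondPercolation (zdGraph d) p), ω ∈ goodCfg d :=
  ProbabilityTheory.setBernoulli_ae_subset

/-- The complement of `goodCfg` is `P_p`-null. [folklore] -/
theorem measure_compl_goodCfg (d : ℕ) (p : unitInterval) :
    bondPercolation (zdGraph d) p (goodCfg d)ᶜ = 0 := by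
  have := ae_mem_goodCfg d p
  rwa [Filter.Eventually, mem_ae_iff] at this

/-- `minGeoEvent o γ` agrees a.e. with its (measurable) cylinder description. [folklore] -/
theorem minGeoEvent_ae_eq_minGeoCyl (p : unitInterval) (o : Orders d n) (γ : Fin n → Fin d × Bool) :
    minGeoEvent o γ =ᵐ[bondPercolation (zdGraph d) p] minGeoCyl o γ := by
  filter_upwards [ae_mem_goodCfg d p] with ω hω
  exact propext (mem_minGeoEvent_iff_mem_minGeoCyl hω o γ)

/-- `minGeoEvent o γ` is `P_p`-null-measurable. [folklore] -/
theorem nullMeasurableSet_minGeoEvent (p : unitInterval) (o : Orders d n) (γ : Fin n → Fin d × Bool) :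
    NullMeasurableSet (minGeoEvent o γ) (bondPercolation (zdGraph d) p) :=
  (measurableSet_minGeoCyl o γ).nullMeasurableSet.congr (minGeoEvent_ae_eq_minGeoCyl p o γ).symm

/-- `geoNonempty d n` is `P_p`-null-measurable. [folklore] -/
theorem nullMeasurableSet_geoNonempty (d n : ℕ) (p : unitInterval) :
    NullMeasurableSet (geoNonempty d n) (bondPercolation (zdGraph d) p) := by
  classical
  rw [geoNonempty_eq_biUnion (fun _ => Equiv.refl _)]
  exact NullMeasurableSet.biUnion (sawWords d n).countable_toSet
    fun γ _ => nullMeasurableSet_minGeoEvent p _ γ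

/-- **The union bound is an identity**: `Σ_{γ ∈ sawWords d n} P_p(minGeoEvent o γ) = P_p(geoNonempty d n)`
for every `n`, `p` and every family of orders `o` — REDUCTIONS.md §R7.1 (event form). [folklore] -/
theorem sum_measureReal_minGeoEvent (d n : ℕ) (p : unitInterval) (o : Orders d n) :
    ∑ γ ∈ sawWords d n, (bondPercolation (zdGraph d) p).real (minGeoEvent o γ) =
      (bondPercolation (zdGraph d) p).real (geoNonempty d n) := by
  rw [geoNonempty_eq_biUnion o, measureReal_biUnion_finset₀]
  · intro γ _ γ' _ hne
    exact (minGeoEvent_disjoint o hne).aedisjoint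
  · intro γ _
    exact nullMeasurableSet_minGeoEvent p o γ

/-- **Every term dominates `θ(p)`**: `θ(p) ≤ P_p(geoNonempty d n)` for all `n`. [folklore] -/
theorem theta_le_measureReal_geoNonempty (d n : ℕ) (p : unitInterval) :
    theta (zdGraph d) 0 p ≤ (bondPercolation (zdGraph d) p).real (geoNonempty d n) := by
  have h1 : (bondPercolation (zdGraph d) p).real (percolatesAt (0 : Site d)) =
      (bondPercolation (zdGraph d) p).real (percolatesAt (0 : Site d) ∩ goodCfg d) := by
    rw [measureReal_def, measureReal_def, measure_inter_conull (measure_compl_goodCfg d p)]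
  rw [theta, h1]
  exact measureReal_mono (percolatesAt_inter_goodCfg_subset d n)

/-- **Every term dominates `θ(p)`** (sum form): `θ(p) ≤ Σ_{γ ∈ sawWords d n} P_p(minGeoEvent o γ)`.
[folklore] -/
theorem theta_le_sum_minGeoEvent (d n : ℕ) (p : unitInterval) (o : Orders d n) :
    theta (zdGraph d) 0 p ≤ ∑ γ ∈ sawWords d n, (bondPercolation (zdGraph d) p).real (minGeoEvent o γ) := by
  rw [sum_measureReal_minGeoEvent]
  exact theta_le_measureReal_geoNonempty d n p

/-- `n ↦ P_p(geoNonempty d n)` is non-increasing. [folklore] -/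
theorem measureReal_geoNonempty_antitone (d : ℕ) (p : unitInterval) :
    Antitone fun n => (bondPercolation (zdGraph d) p).real (geoNonempty d n) :=
  fun _ _ h => measureReal_mono (geoNonempty_antitone d h)

/-- **Exactness of the union bound**: `P_p(geoNonempty d n) → θ(p)` as `n → ∞` (continuity of the
measure along the decreasing events, whose intersection is `{|C(0)| = ∞}` a.e.). [folklore] -/
theorem tendsto_measureReal_geoNonempty (d : ℕ) (p : unitInterval) :
    Tendsto (fun n => (bondPercolation (zdGraph d) p).real (geoNonempty d n)) atTop
      (𝓝 (theta (zdGraph d) 0 p)) := by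
  set μ := bondPercolation (zdGraph d) p with hμ
  have hgood : μ (goodCfg d)ᶜ = 0 := measure_compl_goodCfg d p
  set s : ℕ → Set (BondConfig (Site d)) := fun n => geoNonempty d n ∩ goodCfg d with hs
  have hsm : ∀ n, NullMeasurableSet (s n) μ := fun n =>
    (nullMeasurableSet_geoNonempty d n p).inter (NullMeasurableSet.of_null hgood).of_compl
  have hanti : Antitone s := fun a b h => Set.inter_subset_inter_left _ (geoNonempty_antitone d h)
  have hlim := tendsto_measure_iInter_atTop hsm hanti ⟨0, measure_ne_top μ _⟩
  have hI : (⋂ n, s n) = percolatesAt (0 : Site d) ∩ goodCfg d := by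
    rw [← iInter_geoNonempty_inter_goodCfg]
    ext ω
    simp only [hs, Set.mem_iInter, Set.mem_inter_iff]
    exact ⟨fun h => ⟨fun i => (h i).1, (h 0).2⟩, fun h i => ⟨h.1 i, h.2⟩⟩
  rw [hI, measure_inter_conull hgood] at hlim
  have hsn : ∀ n, μ (s n) = μ (geoNonempty d n) := fun n => measure_inter_conull hgood
  simp only [Function.comp_def, hsn] at hlim
  rw [theta]
  simp only [measureReal_def]
  exact (ENNReal.tendsto_toReal (measure_ne_top μ _)).comp hlim

/-- **Exactness of the geodesic-word union bound (REDUCTIONS.md §R7.1, kernel form).** For every `p` and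
every choice of sibling orders `o n` (one family per length), the exact union bound
`Σ_{γ ∈ sawWords d n} P_p(γ is the code-least open geodesic word of length n)` converges to `θ(p)` as
`n → ∞`; by `theta_le_sum_minGeoEvent` it does so from above.  All certified lower bounds of the lane
bound these sums termwise from above by window-computable weights (`minGeoEvent_subset_chordRandEvent`).
[folklore] -/
theorem tendsto_sum_minGeoEvent (d : ℕ) (p : unitInterval) (o : ∀ n, Orders d n) :
    Tendsto (fun n => ∑ γ ∈ sawWords d n, (bondPercolation (zdGraph d) p).real (minGeoEvent (o n) γ))
      atTop (𝓝 (theta (zdGraph d) 0 p)) := by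
  simp only [sum_measureReal_minGeoEvent]
  exact tendsto_measureReal_geoNonempty d p

/-- Below `p_c` the exact union bound tends to `0`: for `p < p_c^bond(ℤ^d)` and any orders,
`Σ_{γ ∈ sawWords d n} P_p(minGeoEvent (o n) γ) → 0`. [folklore] -/
theorem tendsto_sum_minGeoEvent_of_lt_criticalProb (d : ℕ) (p : unitInterval) (o : ∀ n, Orders d n)
    (hp : (p : ℝ) < criticalProb (zdGraph d) 0) :
    Tendsto (fun n => ∑ γ ∈ sawWords d n, (bondPercolation (zdGraph d) p).real (minGeoEvent (o n) γ))
      atTop (𝓝 0) := by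
  have h := tendsto_sum_minGeoEvent d p o
  rwa [theta_eq_zero_of_lt_criticalProb_holds (zdGraph d) 0 p hp] at h

end Summit.CriticalPhenomena.PercolationContinuityZ3.Theorems.Pcint
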